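import Mathlib
import Literature.MathematicalPhysics.QuantumLattice.EuclideanAction

/-!
# Sketch — crux-ideate stmt-QuantumFields-11685 (ShellRigidity), ideator 1, round 1

First lemmas of the two idea cards `rapidity-liouville-spin-cutoff` (engine) and
`transverse-smearing-planar-threshold` (transfer 4D → 2D), stated over Mathlib + the tree.
Nothing here is proved; the point is that the statements elaborate.
-/

namespace Summit.QuantumFields.YangMills.Cruxes.ShellRigidity.Sketch

open MeasureTheory Complex
open scoped BigOperators

/-- Hypothesis package of a PLANAR FOUR-MIRROR KERNEL of singularity order `σ`:
`F : ℝ × ℝ → ℝ` continuous off the origin, `|F| ≤ C (1 + r^{-σ})`, `D₄`-symmetric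
(`(t,s) ↦ (s,t)`, `(t,s) ↦ (t,-s)`, `(t,s) ↦ (-t,s)`), pointwise OS-positive across the axis
mirror `t = 0` (reflection `(t,s) ↦ (-t,s)`, positive side `t > 0`) and across the diagonal mirror
`t = s` (reflection `(t,s) ↦ (s,t)`, positive side `t > s`). -/
def IsPlanarMirrorKernel (F : ℝ × ℝ → ℝ) (σ : ℝ) : Prop :=
  ContinuousOn F {x | x ≠ 0} ∧
  (∃ C : ℝ, ∀ x : ℝ × ℝ, x ≠ 0 → |F x| ≤ C * (1 + (x.1 ^ 2 + x.2 ^ 2) ^ (-(σ / 2)))) ∧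
  (∀ t s : ℝ, F (t, s) = F (s, t) ∧ F (t, s) = F (t, -s) ∧ F (t, s) = F (-t, s)) ∧
  (∀ (m : ℕ) (x : Fin m → ℝ × ℝ) (c : Fin m → ℝ), (∀ i, 0 < (x i).1) →
      0 ≤ ∑ i, ∑ j, c i * c j * F (-(x i).1 - (x j).1, (x i).2 - (x j).2)) ∧
  (∀ (m : ℕ) (x : Fin m → ℝ × ℝ) (c : Fin m → ℝ), (∀ i, (x i).2 < (x i).1) →
      0 ≤ ∑ i, ∑ j, c i * c j * F ((x i).2 - (x j).1, (x i).1 - (x j).2))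

/-- FIRST LEMMA of card `rapidity-liouville-spin-cutoff` (forward tube + spectral cone):
the axis Laplace–Fourier measure `μ(dE,dp)` of a planar four-mirror kernel is carried by the closed
forward cone `E ≥ |p|`, its Laplace–Fourier integral converges absolutely on the whole forward tube
`Re t > |Im s|` (not only for real `s`), and it represents `F` on the half-plane `t > 0`.
(Cross theorem for separately holomorphic functions ×2, Raikov–Lukacs–Ostrovskii strip theorem,
and the frame-comparison inequality `L_A(2λ) ≤ L_A(λ)`.) -/
def PlanarSpectralCone : Prop :=
  ∀ (F : ℝ × ℝ → ℝ) (σ : ℝ), IsPlanarMirrorKernel F σ →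
    ∃ μ : Measure (ℝ × ℝ), μ {q | q.1 < |q.2|} = 0 ∧
      (∀ t s : ℂ, |s.im| < t.re →
        Integrable (fun q : ℝ × ℝ => Complex.exp (-(q.1 : ℂ) * t + Complex.I * (q.2 : ℂ) * s)) μ) ∧
      ∀ t s : ℝ, 0 < t →
        (F (t, s) : ℂ) = ∫ q, Complex.exp (-(q.1 : ℂ) * t + Complex.I * (q.2 : ℂ) * s) ∂μ

/-- SECOND STATEMENT of card `rapidity-liouville-spin-cutoff` (spin cut-off): on every circle a
planar four-mirror kernel of order `σ` is a trigonometric polynomial in `4φ` of degree `≤ σ/4`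
(the complexified polar angle `w ↦ F(r cos w, r sin w)` is entire, `π/2`-periodic, even, of
exponential type `≤ σ`). -/
def PlanarSpinCutoff : Prop :=
  ∀ (F : ℝ × ℝ → ℝ) (σ : ℝ), IsPlanarMirrorKernel F σ →
    ∃ (N : ℕ) (a : ℕ → ℝ → ℝ), (4 * N : ℝ) ≤ max σ 0 ∧
      ∀ r φ : ℝ, 0 < r →
        F (r * Real.cos φ, r * Real.sin φ) =
          ∑ j ∈ Finset.range (N + 1), a j r * Real.cos (4 * (j : ℝ) * φ)

/-- The TRANSFER TARGET `C⁺` of card `transverse-smearing-planar-threshold` (= the theorem the engine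
card proves): a planar four-mirror kernel of singularity order `σ < 8` is radial. Sharp: the fibres of
`(Σ_μ ∂_μ⁴)² G_m` have order exactly `8` and the mode `cos 8φ`. -/
def PlanarShellRigidity : Prop :=
  ∀ (F : ℝ × ℝ → ℝ) (σ : ℝ), IsPlanarMirrorKernel F σ → σ < 8 →
    ∀ r φ : ℝ, 0 < r → F (r * Real.cos φ, r * Real.sin φ) = F (r, 0)

local notation "E4" => EuclideanSpace ℝ (Fin 4)

/-- the point of `ℝ⁴` with coordinates `(t, s, z.1, z.2)` -/
noncomputable def pt (t s : ℝ) (z : ℝ × ℝ) : E4 :=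
  (WithLp.equiv 2 (Fin 4 → ℝ)).symm ![t, s, z.1, z.2]

open Literature.MathematicalPhysics.QuantumLattice in
/-- The hypothesis package of the crux `PencilRigidity.ShellRigidity`, with the exponent `η` explicit. -/
def IsMirrorKernel4 (K : E4 → ℝ) (η : ℝ) : Prop :=
  ContinuousOn K {x | x ≠ 0} ∧ 0 < η ∧
  (∃ C : ℝ, ∀ x : E4, x ≠ 0 → |K x| ≤ C * (1 + ‖x‖ ^ (η - 10))) ∧
  (∀ R : E4 ≃ₗᵢ[ℝ] E4, (∀ i : Fin 4, ∃ j : Fin 4, R (EuclideanSpace.single i 1) = EuclideanSpace.single j 1 ∨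
      R (EuclideanSpace.single i 1) = -EuclideanSpace.single j 1) → ∀ x : E4, K (R x) = K x) ∧
  (∀ (m : ℕ) (x : Fin m → E4) (c : Fin m → ℝ), (∀ i, 0 < x i 0) →
      0 ≤ ∑ i, ∑ j, c i * c j * K (timeReflection 4 (x i) - x j)) ∧
  (∀ (m : ℕ) (x : Fin m → E4) (c : Fin m → ℝ), (∀ i, x i 1 < x i 0) →
      0 ≤ ∑ i, ∑ j, c i * c j * K (LinearIsometryEquiv.piLpCongrLeft 2 ℝ ℝ (Equiv.swap (0 : Fin 4) 1) (x i) - x j))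

/-- The transverse autocorrelation smearing of a 4D kernel by a weight `h` on the plane `(x₂,x₃)`,
which is contained in all four mirrors `x₀ = 0`, `x₁ = 0`, `x₀ = ± x₁`. -/
noncomputable def smear (K : E4 → ℝ) (h : ℝ × ℝ → ℝ) : ℝ × ℝ → ℝ :=
  fun x => ∫ y, ∫ y', h y * h y' * K (pt x.1 x.2 (y - y'))

/-- FIRST LEMMA of card `transverse-smearing-planar-threshold`: smearing turns the 4D kernel into a
planar four-mirror kernel and LOWERS THE SINGULARITY ORDER BY EXACTLY TWO (`10 - η ↦ 8 - η`),
landing on the sharp planar threshold `8`. -/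
def TransverseSmearing : Prop :=
  ∀ (K : E4 → ℝ) (η : ℝ), IsMirrorKernel4 K η →
    ∀ h : ℝ × ℝ → ℝ, Continuous h → HasCompactSupport h → IsPlanarMirrorKernel (smear K h) (8 - η)

/-- SECOND LEMMA of card `transverse-smearing-planar-threshold` (polarisation): radiality of every
smeared kernel gives invariance of `K` under the rotations of the `(x₀,x₁)`-plane at EVERY transverse
offset; with `W(B₄)` (conjugating `SO(2)₀₁` to all six coordinate planes, and `-1`, reflections
already in `W(B₄)`) this is the conclusion of `ShellRigidity`. -/
def PlanarRadialLift : Prop :=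
  ∀ (K : E4 → ℝ) (η : ℝ), IsMirrorKernel4 K η →
    (∀ h : ℝ × ℝ → ℝ, Continuous h → HasCompactSupport h →
      ∀ r φ : ℝ, 0 < r → smear K h (r * Real.cos φ, r * Real.sin φ) = smear K h (r, 0)) →
    ∀ (θ t s : ℝ) (z : ℝ × ℝ), pt t s z ≠ 0 →
      K (pt (t * Real.cos θ - s * Real.sin θ) (t * Real.sin θ + s * Real.cos θ) z) = K (pt t s z)

/-- How the two cards compose into the crux (statement only; `ShellRigidity` itself lives in
`Summits/QuantumFields/YangMills/Theses/PencilRigidity.lean`). -/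
def LineComposition : Prop :=
  TransverseSmearing → PlanarShellRigidity → PlanarRadialLift →
    ∀ (K : E4 → ℝ) (η : ℝ), IsMirrorKernel4 K η → ∀ (R : E4 ≃ₗᵢ[ℝ] E4) (x : E4), x ≠ 0 → K (R x) = K x

end Summit.QuantumFields.YangMills.Cruxes.ShellRigidity.Sketch
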